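import Mathlib
import HarnessLib
import HarnessLib.Audit
import Literature.NumberTheory.LFunctions.BombieriWeilTruncations

/-!
# D1 (cell rh-split, x-wuc §4.4 / lead 17:16Z, HOURLY #6 «typer-2 optional»): Bombieri's question typed —
# «does the negative eigenvalue of the truncation `𝒦_E(Γ_N)` stay bounded away from zero?»

E. Bombieri, *Remarks on Weil's quadratic functional …* I, Rend. Lincei (9) 11 (2000), p. 3: «the main question here is
to decide whether or not this negative eigenvalue stays bounded away from zero». Typed over the tree's vendored
objects `Bombieri2000.KMat` (the matrix `𝒦_E(Γ)` of (9.1)), `Bombieri2000.ZeroIdx` (zero slots with multiplicity),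
`ZeroIdx.gamma` (`γ = −i(ρ − ½)`), `ZeroIdx.trunc N` / `trunc_finite` (the truncation `Γ_N`). This is the candidate
partner B′ of `CofiniteCriticalLine` named by the x-wuc card (§4.4: «WHAT WOULD BE A REAL PARTNER»), whose
RH-equivalence given FOZ is Bombieri's Theorems 9–11 rather than a sampling triviality. ONLY THE DEFINITION is typed
(definition request D1); no implication is claimed here — `B′ ∧ FOZ ∧ WeilPositivityOn 1 ⟹ RH` needs the eigenvector
provenance of Theorem 11, which the vendored `Bombieri2000.theorem11` does not retain (x-wuc audit note).
Under RH the truncations have no negative eigenvalue (Theorem 9: their number is the number of off-line conjugate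
pairs), so B′ is RH-implied (vacuously) — not typed here either (Theorem 9 is a named fact).
Filed by rh-split-typer-2 g2 (lead GO 19:40Z item (6a); matrix row D1; typed by typer-2 g0 19:08Z, farm rc 0) as a
DEFINITION file on the cell's `Theorems/Splittings/` shelf (review-queued by design); supports the FOZ crux
`Theses.RuelleBand.CofiniteCriticalLine` (stmt-RiemannHypothesis-2064) only as the typed vocabulary of its candidate
partner B′ — no implication is claimed.
HONEST LABEL: SPLITTING SEARCH over kernel-typed RH-EQUIVALENCES; conditional bookkeeping; nothing here bears on the
truth of RH.
-/

set_option linter.dupNamespace false  -- the mandated namespace repeats `RiemannHypothesis`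

noncomputable section

open scoped Classical

namespace Summit.RiemannHypothesis.RiemannHypothesis.Theorems.Splittings.BombieriTruncEigen

open Literature.NumberTheory.LFunctions Literature.NumberTheory.LFunctions.Bombieri2000

/-- The truncated family `Γ_N` as a finite index type: the zero slots `i` with `‖ρ_i − ½‖ ≤ N`. [cite: Bombieri2000Weil, §10 (definition of Γ_N)] -/
def truncIdx (N : ℕ) : Finset ZeroIdx := (ZeroIdx.trunc_finite (N : ℝ)).toFinset

/-- The truncation matrix `𝒦_E(Γ_N)` of (9.1) on the window `E`, indexed by `Γ_N`. [cite: Bombieri2000Weil, §9 (9.1) and §10] -/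
def truncKMat (E : Set ℝ) (N : ℕ) : Matrix (truncIdx N) (truncIdx N) ℂ :=
  KMat E (fun i : truncIdx N ↦ (i : ZeroIdx).gamma)

/-- **D1 / B′ — Bombieri's question as a conjecture** («the main question here is to decide whether or not this
negative eigenvalue stays bounded away from zero», p. 3): on the window `E` there are `c > 0` and `N₀` such that for
every `N ≥ N₀` every real NEGATIVE eigenvalue `λ` of `𝒦_E(Γ_N)` (root of the characteristic polynomial with
`Im λ = 0`, `Re λ < 0`) satisfies `Re λ ≤ −c`. OPEN; RH-implied vacuously via Theorem 9 (no negative eigenvalues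
under RH). [cite: Bombieri2000Weil, §1 p. 3 (the main question) and §10–11] -/
@[conjecture] def TruncNegEigenvalueBoundedAway (E : Set ℝ) : Prop :=
  ∃ c : ℝ, 0 < c ∧ ∃ N₀ : ℕ, ∀ N : ℕ, N₀ ≤ N →
    ∀ μ : ℂ, μ ∈ (truncKMat E N).charpoly.roots → μ.im = 0 → μ.re < 0 → μ.re ≤ -c

/-- Sanity (non-vacuity of the quantifier structure): if some truncation beyond `N₀` HAS a negative real eigenvalue
in `(−c, 0)`, the conjecture with those constants fails — i.e. the statement really constrains the negative
spectrum. [folklore] -/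
theorem not_boundedAway_witness {E : Set ℝ} {c : ℝ} {N₀ N : ℕ} (hN : N₀ ≤ N) {μ : ℂ}
    (hμ : μ ∈ (truncKMat E N).charpoly.roots) (him : μ.im = 0) (hneg : μ.re < 0) (hclose : -c < μ.re) :
    ¬ (∀ N : ℕ, N₀ ≤ N → ∀ μ : ℂ, μ ∈ (truncKMat E N).charpoly.roots → μ.im = 0 → μ.re < 0 → μ.re ≤ -c) :=
  fun h ↦ absurd (h N hN μ hμ him hneg) (not_le.2 hclose)

end Summit.RiemannHypothesis.RiemannHypothesis.Theorems.Splittings.BombieriTruncEigen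

end
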